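import Summits.HodgeConjecture.HodgeConjecture.Theorems.HLiu418E1pHilbert
import Summits.HodgeConjecture.HodgeConjecture.Theorems.HLiu418E1pLevel
import Summits.HodgeConjecture.HodgeConjecture.Theorems.HLiu418E1pArchCoefficient
import Literature.NumberTheory.Automorphic.UnitaryGroupCongruenceLevels
import HarnessLib

/-!
# Crux `HLiu418`, K-lane E1′₂ (collapse road) — piece T: an irreducible smooth `σ` occurring in a `(1,0)`-type discrete `P` is REALISED
# by an equivariant family of cone-holomorphic cotangent forms contained in `P`

Cell `hodgecm-mathlib`, FLOOR 0, programme P5 (`F0_AlbCm`); crux item `stmt-HodgeConjecture-24832`; seat F0P5-p02 (g3),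
`--supports stmt-HodgeConjecture-24832` (helper; piece T of the K-E1′₂ collapse road `F0/P5/p02/DEAL-KE1prime-collapse.v1`).
THEOREMS ONLY — no definition, no instance, no notation, no `sorry`.

SETTING: generic rank-2 unitary datum `U(J)` (`𝒰 = adelicGroupData F E c 2 J`), complex place `w₁`, cone frame `𝔣` with the two frame
hypotheses `⟪v₀,t₀⟫ = 0`, `⟪v₀,v₀⟫ = −r⟪t₀,t₀⟫`, compact automorphic quotient, automorphic measure `μ`, `R = 𝒰.rightRegular μ`.

THE ARGUMENT.  Let `P` be a discrete automorphic representation containing the class `[f₀]` of a non-zero `f₀ ∈ holCotForms₂ … 𝔣`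
(`IsHolCotangentAt₂`), `σ` an irreducible smooth representation of `U(J)(𝔸_{F,f})` on `W` and `j : σ → P|_{U(J)(𝔸_{F,f})}` an injective
intertwiner (`HasFinComponent`).  Put `N := {h ∈ holCotForms₂ … 𝔣 ∣ P.ContainsFun h}` (§1: a `rightRep₂`-stable subspace), `Λ : N → L²`
its class map (★ `E1pLevel.exists_clsMapN`), `S :=` the closure of `Λ(N)` — a closed `R(1,·)`-stable subspace of `P` (§2).  By the
non-vanishing of matrix coefficients in the irreducible `P` (★ `E1pHilbert.exists_inner_rightRegular_ne_zero`) and the three-factor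
decomposition `x = ι(u₀) · k · (1,g₀)` (★ `exists_eq_adelicSingle_mul_kerArchAt_mul_finAdelicToAdelic`, `K_c` idle on `N`), some
archimedean translate `R(ι u₀) Λ f₁`, `f₁ = R_{g₀} f₀ ∈ N`, pairs non-trivially with `j w₀`.  The map
`T̃ := pr_S ∘ R(ι u₀)⁻¹ ∘ j : W → S` is linear, `U(J)(𝔸_{F,f})`-equivariant (`pr_S` commutes with `R(1,·)`: ★
`E1pHilbert.starProjection_rightRegular_comm`; `ι(u₀)` commutes with `(1,g)`), and `T̃ w₀ ≠ 0`.  Since `σ` is smooth, `T̃ w` is fixed by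
a compact open subgroup `K_w`, hence is the class of a member of `N` (★ `E1pLevel.exists_eq_clsMap_of_mem_closure_of_fixed`: the
`K`-fixed vectors of the closure of `Λ(N)` are classes of `N ∩ Fix K`, by level finiteness and finite averaging); `Λ` being injective,
`T̃ = Λ ∘ ψ` for a unique linear `ψ : W → N`, which is equivariant and non-zero (§3).  Head: **`exists_holValued_of_hasFinComponent`** —
the binder shape `ψ hE hV hne` of ★ `E2LevelFinite.admissibleOfHolValued₂_holds` ∕ ★ `E1pOfE1.eq_of_discIdentity_of_holRealised`.
No tensor-product decomposition `P ≅ P_∞ ⊗ P_f`, no `(𝔤,K)`-modules.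
HONEST LABEL: HC_CM is proved only modulo the 7 printed citations until rung 0 closes; this file discharges none of them.

## References
* [BorelJacquet1979] A. Borel, H. Jacquet, Corvallis PSPM 33.1 (1979), §4.2 (smooth vectors), §4.6 (`L²_d`, finite components).
* [BernsteinZelevinsky1976] I. N. Bernstein, A. V. Zelevinsky, Russian Math. Surveys 31 (1976), §2.1 (smooth ∕ admissible).
* [Dixmier1977] J. Dixmier, *C\*-algebras* (1977), §2.3 (invariant subspaces and their projections), §13.1.
* [Liu2021] Y. Liu, Camb. J. Math. 9 (2021), App. D §D.1–§D.3 (the cohomological `π^{1,0}_{1,1}` and finite components).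
-/

set_option autoImplicit false
-- the mandated namespace has the single-problem summit's repeated segment (`HodgeConjecture.HodgeConjecture`)
set_option linter.dupNamespace false

noncomputable section

open Matrix MeasureTheory NumberField NumberField.InfinitePlace Metric Topology
open scoped Matrix ComplexConjugate ComplexOrder InnerProductSpace
open Literature.NumberTheory.Automorphic Literature.NumberTheory.Automorphic.UnitaryGroup
open Literature.NumberTheory.Automorphic.UnitaryGroup.CotangentForms (toQuotFun toQuotFun_mk)
open Literature.NumberTheory.Automorphic.UnitaryCurveForms
open Summit.HodgeConjecture.HodgeConjecture.Cruxes.H413.SpectrumJunction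
open Summit.HodgeConjecture.HodgeConjecture.Cruxes.HLiu418.E2Density
open Summit.HodgeConjecture.HodgeConjecture.Cruxes.HLiu418.E2ArchOrthHolPrep
open Summit.HodgeConjecture.HodgeConjecture.Cruxes.HLiu418.E2ArchOrthHolCM
open Summit.HodgeConjecture.HodgeConjecture.Cruxes.HLiu418.E1pHilbert
open Summit.HodgeConjecture.HodgeConjecture.Cruxes.HLiu418.E2Bootstrap
open Summit.HodgeConjecture.HodgeConjecture.Cruxes.HLiu418.E1pLevel

namespace Summit.HodgeConjecture.HodgeConjecture.Cruxes.HLiu418.E1pRealise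

variable {F E : Type} [Field F] [NumberField F] [Field E] [NumberField E] [Algebra F E]
  {c : E ≃ₐ[F] E} {J : Matrix (Fin 2) (Fin 2) E}
  {hc : c ≠ 1} {hfix : ∀ w : InfinitePlace E, c • w = w} {w₁ : {w : InfinitePlace E // IsComplex w}} {𝔣 : ConeFrame E J w₁}
  {μ : Measure (adelicGroupData F E c 2 J).automorphicQuotient} [(adelicGroupData F E c 2 J).IsAutomorphicMeasure μ]

/-! ## §1 The space `N = {h ∈ holCotForms₂ ∣ P.ContainsFun h}` of cone-holomorphic cotangent forms contained in `P` -/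

/-- `P.ContainsFun` is stable under sums. [cite: BorelJacquet1979, §4.6] -/
theorem containsFun_add (P : DiscreteAutomorphicRep (adelicGroupData F E c 2 J) μ)
    {f h : (adelicGroupData F E c 2 J).Adelic → ℂ} (hf : P.ContainsFun f) (hh : P.ContainsFun h) : P.ContainsFun (f + h) := by
  obtain ⟨h1, h1P⟩ := hf
  obtain ⟨h2, h2P⟩ := hh
  have hfun : toQuotFun (adelicGroupData F E c 2 J) (f + h) =
      toQuotFun (adelicGroupData F E c 2 J) f + toQuotFun (adelicGroupData F E c 2 J) h := by
    funext y
    simp only [toQuotFun, Pi.add_apply]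
  have hmem : MemLp (toQuotFun (adelicGroupData F E c 2 J) (f + h)) 2 μ := by
    rw [hfun]
    exact h1.add h2
  refine ⟨hmem, ?_⟩
  have heq : hmem.toLp (toQuotFun (adelicGroupData F E c 2 J) (f + h)) =
      h1.toLp (toQuotFun (adelicGroupData F E c 2 J) f) + h2.toLp (toQuotFun (adelicGroupData F E c 2 J) h) := by
    rw [← MemLp.toLp_add]
    exact MemLp.toLp_congr _ _ (Filter.EventuallyEq.of_eq hfun)
  rw [heq]
  exact P.space.toSubmodule.add_mem h1P h2P

/-- `P.ContainsFun` is stable under scalars. [cite: BorelJacquet1979, §4.6] -/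
theorem containsFun_smul (P : DiscreteAutomorphicRep (adelicGroupData F E c 2 J) μ)
    {f : (adelicGroupData F E c 2 J).Adelic → ℂ} (hf : P.ContainsFun f) (a : ℂ) : P.ContainsFun (a • f) := by
  obtain ⟨h1, h1P⟩ := hf
  have hfun : toQuotFun (adelicGroupData F E c 2 J) (a • f) = a • toQuotFun (adelicGroupData F E c 2 J) f := by
    funext y
    simp only [toQuotFun, Pi.smul_apply, smul_eq_mul]
  have hmem : MemLp (toQuotFun (adelicGroupData F E c 2 J) (a • f)) 2 μ := by
    rw [hfun]
    exact h1.const_smul a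
  refine ⟨hmem, ?_⟩
  have heq : hmem.toLp (toQuotFun (adelicGroupData F E c 2 J) (a • f)) = a • h1.toLp (toQuotFun (adelicGroupData F E c 2 J) f) := by
    rw [← MemLp.toLp_const_smul]
    exact MemLp.toLp_congr _ _ (Filter.EventuallyEq.of_eq hfun)
  rw [heq]
  exact P.space.toSubmodule.smul_mem a h1P

/-- `P.ContainsFun 0`. [cite: BorelJacquet1979, §4.6] -/
theorem containsFun_zero (P : DiscreteAutomorphicRep (adelicGroupData F E c 2 J) μ) :
    P.ContainsFun (0 : (adelicGroupData F E c 2 J).Adelic → ℂ) := by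
  have hfun : toQuotFun (adelicGroupData F E c 2 J) (0 : (adelicGroupData F E c 2 J).Adelic → ℂ) = 0 := by
    funext y
    simp only [toQuotFun, Pi.zero_apply]
  have hmem : MemLp (toQuotFun (adelicGroupData F E c 2 J) (0 : (adelicGroupData F E c 2 J).Adelic → ℂ)) 2 μ := by
    rw [hfun]
    exact MemLp.zero
  refine ⟨hmem, ?_⟩
  have hzero : MemLp (0 : (adelicGroupData F E c 2 J).automorphicQuotient → ℂ) 2 μ := MemLp.zero
  have heq : hmem.toLp (toQuotFun (adelicGroupData F E c 2 J) (0 : (adelicGroupData F E c 2 J).Adelic → ℂ)) = 0 :=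
    (MemLp.toLp_congr hmem hzero (Filter.EventuallyEq.of_eq hfun)).trans (MemLp.toLp_zero hzero)
  rw [heq]
  exact P.space.toSubmodule.zero_mem

/-- A non-zero vector of an irreducible representation (irreducible representations are non-zero). [cite: BernsteinZelevinsky1976, §2.1] -/
theorem exists_ne_zero_of_isIrreducible {G : Type*} [Group G] {W : Type*} [AddCommGroup W] [Module ℂ W] (σ : Representation ℂ G W)
    (hirr : σ.IsIrreducible) : ∃ w₀ : W, w₀ ≠ 0 := by
  haveI := hirr
  by_contra h
  push Not at h
  have hbt : (⊥ : Subrepresentation σ) = ⊤ :=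
    Subrepresentation.toSubmodule_injective (Submodule.ext fun w => by
      change w ∈ (⊥ : Submodule ℂ W) ↔ w ∈ (⊤ : Submodule ℂ W)
      simp only [Submodule.mem_bot, h w, Submodule.mem_top])
  exact bot_ne_top hbt

/-- `(P.finRep g v : L²) = R(1,g) v`. [cite: BorelJacquet1979, §4.6] -/
theorem coe_finRep_apply (P : DiscreteAutomorphicRep (adelicGroupData F E c 2 J) μ) (g : finAdelic F E c 2 J) (v : P.space.toSubmodule) :
    ((P.finRep g v : P.space.toSubmodule) : (adelicGroupData F E c 2 J).L2 μ) =
      (adelicGroupData F E c 2 J).rightRegular μ (finAdelicToAdelic F E c 2 J g) (v : (adelicGroupData F E c 2 J).L2 μ) := rfl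

variable [CompactSpace (adelicGroupData F E c 2 J).automorphicQuotient]

/-- **`P.ContainsFun` is stable under finite-adelic right translation of cone cotangent forms**: `[R_g f] = R(1,g)[f] ∈ P`
(★ `rightRegular_toLp_eq`, `P` invariant). [cite: BorelJacquet1979, §4.6] -/
theorem containsFun_rightRep₂ (P : DiscreteAutomorphicRep (adelicGroupData F E c 2 J) μ)
    {f : (adelicGroupData F E c 2 J).Adelic → ℂ} (hf : f ∈ holCotForms₂ F E c J hc hfix w₁ 𝔣) (hP : P.ContainsFun f)
    (g : finAdelic F E c 2 J) : P.ContainsFun (rightRep₂ F E c J g f) := by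
  obtain ⟨h1, h1P⟩ := hP
  have hfun : (rightRep₂ F E c J g f) = fun x => f (x * finAdelicToAdelic F E c 2 J g) := funext fun x => rightRep₂_apply F E c J g f x
  refine ⟨hfun ▸ memLp_toQuotFun_mul_right (μ := μ) hf (finAdelicToAdelic F E c 2 J g), ?_⟩
  have heq : (hfun ▸ memLp_toQuotFun_mul_right (μ := μ) hf (finAdelicToAdelic F E c 2 J g)).toLp
        (toQuotFun (adelicGroupData F E c 2 J) (rightRep₂ F E c J g f)) =
      (adelicGroupData F E c 2 J).rightRegular μ (finAdelicToAdelic F E c 2 J g) (h1.toLp (toQuotFun (adelicGroupData F E c 2 J) f)) := by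
    rw [rightRegular_toLp_eq hf h1]
    exact MemLp.toLp_congr _ _ (Filter.EventuallyEq.of_eq (by rw [hfun]))
  rw [heq]
  exact P.space.apply_mem _ h1P

/-! ## §2 The realisation -/

/-- **PIECE T — `exists_holValued_of_hasFinComponent`.**  For a discrete automorphic `P` of `U(J)` of Hodge type `(1,0)` at `w₁`
(`IsHolCotangentAt₂`), an irreducible smooth `σ` on `W` occurring in `P|_{U(J)(𝔸_{F,f})}` (`HasFinComponent`): there is a NON-ZERO linear
`ψ : W → (U(J)(𝔸_F) → ℂ)`, equivariant for `rightRep₂`, all of whose values are cone-holomorphic cotangent forms contained in `P`.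
Proof: the module docstring. [cite: BorelJacquet1979, §4.2 and §4.6] [cite: Dixmier1977, §2.3] [cite: Liu2021, App. D §D.1–§D.3] -/
theorem exists_holValued_of_hasFinComponent (hvt : star 𝔣.v₀ ⬝ᵥ (J.map w₁.1.embedding *ᵥ 𝔣.t₀) = 0) {r : ℝ} (hr : 0 < r)
    (hvv : star 𝔣.v₀ ⬝ᵥ (J.map w₁.1.embedding *ᵥ 𝔣.v₀) = -(r : ℂ) * (star 𝔣.t₀ ⬝ᵥ (J.map w₁.1.embedding *ᵥ 𝔣.t₀)))
    (P : DiscreteAutomorphicRep (adelicGroupData F E c 2 J) μ) (hP : P.IsHolCotangentAt₂ hc hfix w₁ 𝔣)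
    {W : Type} [AddCommGroup W] [Module ℂ W] (σ : Representation ℂ (finAdelic F E c 2 J) W)
    (hirr : σ.IsIrreducible) (hsm : σ.IsSmooth) (hσ : P.HasFinComponent σ) :
    ∃ ψ : W →ₗ[ℂ] ((adelicGroupData F E c 2 J).Adelic → ℂ),
      (∀ (k : finAdelic F E c 2 J) (w : W), ψ (σ k w) = rightRep₂ F E c J k (ψ w)) ∧
      (∀ w : W, ψ w ∈ holCotForms₂ F E c J hc hfix w₁ 𝔣 ∧ P.ContainsFun (ψ w)) ∧ ψ ≠ 0 := by
  classical
  -- §1: the space `N`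
  let N : Submodule ℂ ((adelicGroupData F E c 2 J).Adelic → ℂ) :=
    { carrier := {h | h ∈ holCotForms₂ F E c J hc hfix w₁ 𝔣 ∧ P.ContainsFun h}
      add_mem' := fun {a b} ha hb => ⟨Submodule.add_mem _ ha.1 hb.1, containsFun_add P ha.2 hb.2⟩
      zero_mem' := ⟨Submodule.zero_mem _, containsFun_zero P⟩
      smul_mem' := fun r a ha => ⟨Submodule.smul_mem _ r ha.1, containsFun_smul P ha.2 r⟩ }
  have hmemN : ∀ h, h ∈ N ↔ h ∈ holCotForms₂ F E c J hc hfix w₁ 𝔣 ∧ P.ContainsFun h := fun _ => Iff.rfl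
  have hN : N ≤ holCotForms₂ F E c J hc hfix w₁ 𝔣 := fun h hh => ((hmemN h).1 hh).1
  have hNst : ∀ (g : finAdelic F E c 2 J), ∀ f ∈ N, rightRep₂ F E c J g f ∈ N := fun g f hf =>
    (hmemN _).2 ⟨rightRep₂_mem_holCotForms₂ F E c J hc hfix w₁ 𝔣 g ((hmemN f).1 hf).1,
      containsFun_rightRep₂ P ((hmemN f).1 hf).1 ((hmemN f).1 hf).2 g⟩
  -- the class map (L0)
  obtain ⟨Λ, hΛ, hΛinj, hΛE⟩ := exists_clsMapN (μ := μ) N hN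
  -- `Λ(N) ⊆ P`
  have hΛP : ∀ f : N, Λ f ∈ P.space.toSubmodule := by
    intro f
    obtain ⟨hm, hmP⟩ := ((hmemN f.1).1 f.2).2
    rw [hΛ f hm]
    exact hmP
  -- the non-zero class `Λ f₀`
  obtain ⟨f₀, hf₀, hf₀ne, hf₀P⟩ := hP
  have hf₀N : f₀ ∈ N := (hmemN f₀).2 ⟨hf₀, hf₀P⟩
  have hΛf₀ : Λ ⟨f₀, hf₀N⟩ ≠ 0 := by
    rw [hΛ ⟨f₀, hf₀N⟩ (memLp_toQuotFun_self hf₀)]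
    exact toLp_toQuotFun_ne_zero (leftInvariant_of_mem_holCotForms₂ hf₀) (continuous_of_mem_holCotForms₂ F E c J hc hfix w₁ 𝔣 hf₀) _ hf₀ne
  -- the injective intertwiner `j` and a non-zero `w₀`
  obtain ⟨j, hjinj⟩ := hσ
  obtain ⟨w₀, hw₀⟩ := exists_ne_zero_of_isIrreducible σ hirr
  -- a translate of `Λ f₀` pairing non-trivially with `j w₀`
  have hjw₀ : j w₀ ≠ 0 := fun h0 => hw₀ (hjinj (by rw [h0, map_zero]))
  have hΛf₀' : (⟨Λ ⟨f₀, hf₀N⟩, hΛP ⟨f₀, hf₀N⟩⟩ : P.space.toSubmodule) ≠ 0 := fun h0 => hΛf₀ (congrArg Subtype.val h0)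
  obtain ⟨x, hx⟩ := exists_inner_rightRegular_ne_zero P hΛf₀' hjw₀
  obtain ⟨u₀, k, g₀, hk, rfl⟩ := exists_eq_adelicSingle_mul_kerArchAt_mul_finAdelicToAdelic F E c 2 J hc hfix w₁ x
  set f₁ : N := ⟨rightRep₂ F E c J g₀ f₀, hNst g₀ f₀ hf₀N⟩ with hf₁
  have hf₁hol : (f₁ : (adelicGroupData F E c 2 J).Adelic → ℂ) ∈ holCotForms₂ F E c J hc hfix w₁ 𝔣 := hN f₁.2
  have hRx : (adelicGroupData F E c 2 J).rightRegular μ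
        (adelicSingle F E c 2 J hc hfix w₁ u₀ * k * finAdelicToAdelic F E c 2 J g₀) (Λ ⟨f₀, hf₀N⟩) =
      (adelicGroupData F E c 2 J).rightRegular μ (adelicSingle F E c 2 J hc hfix w₁ u₀) (Λ f₁) := by
    rw [map_mul, map_mul, mul_apply_eq_comp, mul_apply_eq_comp, ← hΛE g₀ ⟨f₀, hf₀N⟩ (hNst g₀ f₀ hf₀N)]
    congr 1
    rw [hΛ f₁ (memLp_toQuotFun_self hf₁hol)]
    exact rightRegular_toLp_of_apply_mul (leftInvariant_of_mem_holCotForms₂ hf₁hol) k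
      (fun y => apply_mul_of_mem_holCotForms₂ hf₁hol hk y) _
  change ⟪(adelicGroupData F E c 2 J).rightRegular μ _ (Λ ⟨f₀, hf₀N⟩), ((j w₀ : P.space.toSubmodule) : (adelicGroupData F E c 2 J).L2 μ)⟫_ℂ ≠ 0 at hx
  rw [hRx] at hx
  -- the equivariant map `z = R(ι u₀)⁻¹ ∘ j : W → L²`
  let z : W →ₗ[ℂ] (adelicGroupData F E c 2 J).L2 μ :=
    ((adelicGroupData F E c 2 J).rightRegular μ (adelicSingle F E c 2 J hc hfix w₁ u₀⁻¹) :
        (adelicGroupData F E c 2 J).L2 μ →L[ℂ] (adelicGroupData F E c 2 J).L2 μ).toLinearMap ∘ₗ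
      (P.space.toSubmodule.subtype ∘ₗ j.toLinearMap)
  have hz : ∀ w, z w = (adelicGroupData F E c 2 J).rightRegular μ (adelicSingle F E c 2 J hc hfix w₁ u₀⁻¹)
      ((j w : P.space.toSubmodule) : (adelicGroupData F E c 2 J).L2 μ) := fun _ => rfl
  have hzE : ∀ (g : finAdelic F E c 2 J) (w : W),
      z (σ g w) = (adelicGroupData F E c 2 J).rightRegular μ (finAdelicToAdelic F E c 2 J g) (z w) := by
    intro g w
    rw [hz, hz, show j (σ g w) = P.finRep g (j w) from Representation.IntertwiningMap.isIntertwining _ _ j g w, coe_finRep_apply,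
      ← mul_apply_eq_comp, ← map_mul, adelicSingle_mul_finAdelicToAdelic F E c 2 J hc hfix w₁ u₀⁻¹ g, map_mul, mul_apply_eq_comp]
  -- the closure `S` of `Λ(N)` and its projection
  set M : Submodule ℂ ((adelicGroupData F E c 2 J).L2 μ) := LinearMap.range Λ with hM
  have hMst : ∀ (g : finAdelic F E c 2 J), ∀ m ∈ M, (adelicGroupData F E c 2 J).rightRegular μ (finAdelicToAdelic F E c 2 J g) m ∈ M := by
    rintro g _ ⟨f, rfl⟩
    exact ⟨⟨rightRep₂ F E c J g f, hNst g f f.2⟩, hΛE g f (hNst g f f.2)⟩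
  set S : Submodule ℂ ((adelicGroupData F E c 2 J).L2 μ) := M.topologicalClosure with hS
  haveI : CompleteSpace S := M.isClosed_topologicalClosure.completeSpace_coe
  have hSst : ∀ (g : finAdelic F E c 2 J), ∀ m ∈ S, (adelicGroupData F E c 2 J).rightRegular μ (finAdelicToAdelic F E c 2 J g) m ∈ S :=
    fun g m hm => rightRegular_mem_topologicalClosure M (fun v hv => hMst g v hv) hm
  have hSst' : ∀ x ∈ (finAdelicToAdelic F E c 2 J).range, ∀ m ∈ S, (adelicGroupData F E c 2 J).rightRegular μ x m ∈ S := by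
    rintro _ ⟨g, rfl⟩ m hm
    exact hSst g m hm
  have hSP : S ≤ P.space.toSubmodule := by
    refine M.topologicalClosure_minimal ?_ P.space.isClosed
    rintro _ ⟨f, rfl⟩
    exact hΛP f
  -- `T̃ = pr_S ∘ z`
  let T : W →ₗ[ℂ] (adelicGroupData F E c 2 J).L2 μ := (S.starProjection : _ →L[ℂ] _).toLinearMap ∘ₗ z
  have hT : ∀ w, T w = S.starProjection (z w) := fun _ => rfl
  have hTE : ∀ (g : finAdelic F E c 2 J) (w : W),
      T (σ g w) = (adelicGroupData F E c 2 J).rightRegular μ (finAdelicToAdelic F E c 2 J g) (T w) := by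
    intro g w
    rw [hT, hT, hzE, starProjection_rightRegular_comm S (finAdelicToAdelic F E c 2 J).range hSst' ⟨g, rfl⟩ (z w)]
  have hTS : ∀ w, T w ∈ S := fun w => by rw [hT]; exact S.starProjection_apply_mem (z w)
  have hTinner : ∀ (f : N) (w : W), ⟪Λ f, z w⟫_ℂ = ⟪Λ f, T w⟫_ℂ := by
    intro f w
    have hΛS : Λ f ∈ S := M.le_topologicalClosure ⟨f, rfl⟩
    have h := Submodule.inner_right_of_mem_orthogonal hΛS (S.sub_starProjection_mem_orthogonal (z w))
    rw [inner_sub_right, sub_eq_zero] at h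
    rw [hT, h]
  -- `T w₀ ≠ 0`
  have hTw₀ : T w₀ ≠ 0 := by
    intro h0
    apply hx
    have h1 : ⟪Λ f₁, z w₀⟫_ℂ = 0 := by rw [hTinner, h0, inner_zero_right]
    rw [hz, E2ArchOrthHolPrep.inner_rightRegular_right, map_inv (adelicSingle F E c 2 J hc hfix w₁) u₀, inv_inv] at h1
    exact h1
  -- every `T w` is the class of a member of `N` (L2: `K`-fixed vectors of the closure are classes)
  have hK₀o : IsOpen ((finCongruenceLevel F E c 2 J ⊤ : Subgroup (finAdelic F E c 2 J)) : Set (finAdelic F E c 2 J)) :=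
    isOpen_finCongruenceLevel F E c 2 J (by simp)
  have hK₀c : IsCompact ((finCongruenceLevel F E c 2 J ⊤ : Subgroup (finAdelic F E c 2 J)) : Set (finAdelic F E c 2 J)) :=
    isCompact_finCongruenceLevel F E c 2 J (by simp)
  have hTcls : ∀ w : W, ∃ f : N, T w = Λ f := by
    intro w
    -- the compact open subgroup `K = K_f(1) ∩ Stab(w)`
    let K : Subgroup (finAdelic F E c 2 J) := finCongruenceLevel F E c 2 J ⊤ ⊓ σ.stabilizerSubgroup w
    have hKo : IsOpen (K : Set (finAdelic F E c 2 J)) := by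
      change IsOpen ((finCongruenceLevel F E c 2 J ⊤ : Set (finAdelic F E c 2 J)) ∩ (σ.stabilizerSubgroup w : Set (finAdelic F E c 2 J)))
      exact hK₀o.inter (hsm w)
    have hKc : IsCompact (K : Set (finAdelic F E c 2 J)) := by
      change IsCompact ((finCongruenceLevel F E c 2 J ⊤ : Set (finAdelic F E c 2 J)) ∩ (σ.stabilizerSubgroup w : Set (finAdelic F E c 2 J)))
      exact hK₀c.inter_right (OpenSubgroup.isClosed ⟨σ.stabilizerSubgroup w, hsm w⟩)
    have hyK : ∀ k ∈ K, (adelicGroupData F E c 2 J).rightRegular μ (finAdelicToAdelic F E c 2 J k) (T w) = T w := by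
      intro k hk
      have hkw : σ k w = w := (σ.mem_stabilizerSubgroup w k).1 (Subgroup.mem_inf.1 hk).2
      rw [← hTE k w, hkw]
    obtain ⟨f, -, hf⟩ := exists_eq_clsMap_of_mem_closure_of_fixed (μ := μ) hvt hr hvv N hN hNst Λ hΛ hKo hKc (hTS w) hyK
    exact ⟨f, hf⟩
  -- `ψ₀ : W → N` with `Λ ∘ ψ₀ = T`, linear by injectivity of `Λ`
  let ψ₀ : W → N := fun w => (hTcls w).choose
  have hψ₀ : ∀ w, Λ (ψ₀ w) = T w := fun w => (hTcls w).choose_spec.symm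
  let ψN : W →ₗ[ℂ] N :=
    { toFun := ψ₀
      map_add' := fun a b => hΛinj (by rw [map_add, hψ₀, hψ₀, hψ₀, map_add])
      map_smul' := fun r a => hΛinj (by rw [map_smul, hψ₀, hψ₀, map_smul, RingHom.id_apply]) }
  have hψN : ∀ w, Λ (ψN w) = T w := hψ₀
  refine ⟨N.subtype ∘ₗ ψN, fun g w => ?_, fun w => (hmemN _).1 (ψN w).2, fun h0 => hTw₀ ?_⟩
  · -- equivariance
    have h1 : Λ (ψN (σ g w)) = Λ ⟨rightRep₂ F E c J g (ψN w : (adelicGroupData F E c 2 J).Adelic → ℂ), hNst g _ (ψN w).2⟩ := by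
      rw [hψN, hTE, ← hψN, hΛE g (ψN w) (hNst g _ (ψN w).2)]
    have h2 := congrArg Subtype.val (hΛinj h1)
    simpa only [LinearMap.coe_comp, Function.comp_apply, Submodule.coe_subtype] using h2
  · -- non-vanishing
    have h1 : (N.subtype ∘ₗ ψN) w₀ = 0 := by rw [h0, LinearMap.zero_apply]
    have h2 : ψN w₀ = 0 := by
      apply Subtype.ext
      simpa only [LinearMap.coe_comp, Function.comp_apply, Submodule.coe_subtype, ZeroMemClass.coe_zero] using h1
    rw [← hψN, h2, map_zero]

/-! ## §3 At the P5 letter binders: the two shapes (A), (C) consumed by ★ `E1pOfE1.curveCohFinComponentUnique_hol_of_shapes` -/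

/-- **Shape (A) at the CM binders** — the disc identity with value (★ `E1pArchCoefficient.exists_archCoefficient`) for the datum
`(L⁺, L, c̄, H)` of the letters `curveMultiplicityLeOne` ∕ `curveCohFinComponentUnique_hol`: the frame hypotheses come from ★
`E2ArchOrthHolCM.frame_hypotheses`, compactness of the quotient from anisotropy (★ `anisotropic_of_formCongr_posDef`, ★
`compactSpace_adelicGroupData_automorphicQuotient`). [cite: Borel1997, §5.13–§5.14 and §15] [cite: BorelWallach2000, VII 3.2] -/
theorem archCoefficient_shape :
    ∀ (L : Type) [Field L] [NumberField L] [IsCMField L] (ι : L →+* ℂ) (H : Matrix (Fin 2) (Fin 2) L)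
      (dV : Fin 2 → L) (_hdV : ∀ i, IsCMField.complexConj L (dV i) = dV i) (_hdV0 : ∀ i, dV i ≠ 0)
      (t : L) (_ht : t ≠ 0) (g : GL (Fin 2) L),
      formCongr ((IsCMField.complexConj L : L ≃ₐ[↥(maximalRealSubfield L)] L) : L →+* L) g (t • H) = Matrix.diagonal dV →
      (∃ T : GL (Fin 2) ℂ, formCongr (starRingEnd ℂ) T ((Matrix.diagonal dV).map ι) = Matrix.diagonal ![(1 : ℂ), -1]) →
      (∀ τ' : L →+* ℂ, InfinitePlace.mk τ' ≠ InfinitePlace.mk ι → ((Matrix.diagonal dV).map τ').PosDef) →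
      4 ≤ Module.finrank ℚ L →
      ∀ (𝔣 : ConeFrame L H (cmPlace L ι))
        (μ : Measure (adelicGroupData (↥(maximalRealSubfield L)) L (IsCMField.complexConj L) 2 H).automorphicQuotient)
        [(adelicGroupData (↥(maximalRealSubfield L)) L (IsCMField.complexConj L) 2 H).IsAutomorphicMeasure μ],
      ∃ m : archLocal L 2 H (cmPlace L ι) → ℂ,
        ∀ (h h₃ : (adelicGroupData (↥(maximalRealSubfield L)) L (IsCMField.complexConj L) 2 H).Adelic → ℂ),
          h ∈ holCotForms₂ (↥(maximalRealSubfield L)) L (IsCMField.complexConj L) H (IsCMField.complexConj_ne_one L)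
            (UnitaryGroup.complexConj_smul_infinitePlace L) (cmPlace L ι) 𝔣 →
          h₃ ∈ holCotForms₂ (↥(maximalRealSubfield L)) L (IsCMField.complexConj L) H (IsCMField.complexConj_ne_one L)
            (UnitaryGroup.complexConj_smul_infinitePlace L) (cmPlace L ι) 𝔣 →
          ∀ (hhm : MemLp (toQuotFun (adelicGroupData (↥(maximalRealSubfield L)) L (IsCMField.complexConj L) 2 H) h) 2 μ)
            (hh₃m : MemLp (toQuotFun (adelicGroupData (↥(maximalRealSubfield L)) L (IsCMField.complexConj L) 2 H) h₃) 2 μ)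
            (u : archLocal L 2 H (cmPlace L ι)),
            ⟪(adelicGroupData (↥(maximalRealSubfield L)) L (IsCMField.complexConj L) 2 H).rightRegular μ
                (adelicSingle (↥(maximalRealSubfield L)) L (IsCMField.complexConj L) 2 H (IsCMField.complexConj_ne_one L)
                  (UnitaryGroup.complexConj_smul_infinitePlace L) (cmPlace L ι) u)
                (hhm.toLp (toQuotFun (adelicGroupData (↥(maximalRealSubfield L)) L (IsCMField.complexConj L) 2 H) h)),
              hh₃m.toLp (toQuotFun (adelicGroupData (↥(maximalRealSubfield L)) L (IsCMField.complexConj L) 2 H) h₃)⟫_ℂ =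
            m u * ⟪hhm.toLp (toQuotFun (adelicGroupData (↥(maximalRealSubfield L)) L (IsCMField.complexConj L) 2 H) h),
              hh₃m.toLp (toQuotFun (adelicGroupData (↥(maximalRealSubfield L)) L (IsCMField.complexConj L) 2 H) h₃)⟫_ℂ := by
  intro L _ _ _ ι H dV hdV _ t ht g hg _ hdef h4 𝔣 μ _
  obtain ⟨τ, hτ⟩ := UnitaryGroup.exists_infinitePlace_ne L h4 ι
  have hanis := S1BettiSliceExclusion.anisotropic_of_formCongr_posDef L H t g dV hg τ (hdef τ hτ)
  haveI := UnitaryGroup.compactSpace_adelicGroupData_automorphicQuotient L 2 H hanis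
  obtain ⟨hvt, r, hr, hvv⟩ := frame_hypotheses ι H dV hdV t ht g hg 𝔣
  obtain ⟨m, hm⟩ := E1pArchCoefficient.exists_archCoefficient (μ := μ) hvt hr hvv
  exact ⟨m, fun h h₃ hh hh₃ hhm hh₃m u => hm h h₃ hh hh₃ hhm hh₃m u⟩

/-- **Shape (C) at the CM binders** — the realisation `exists_holValued_of_hasFinComponent` for the datum of the letters.
[cite: BorelJacquet1979, §4.6] [cite: Liu2021, App. D §D.1–§D.3] -/
theorem holValued_shape :
    ∀ (L : Type) [Field L] [NumberField L] [IsCMField L] (ι : L →+* ℂ) (H : Matrix (Fin 2) (Fin 2) L)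
      (dV : Fin 2 → L) (_hdV : ∀ i, IsCMField.complexConj L (dV i) = dV i) (_hdV0 : ∀ i, dV i ≠ 0)
      (t : L) (_ht : t ≠ 0) (g : GL (Fin 2) L),
      formCongr ((IsCMField.complexConj L : L ≃ₐ[↥(maximalRealSubfield L)] L) : L →+* L) g (t • H) = Matrix.diagonal dV →
      (∃ T : GL (Fin 2) ℂ, formCongr (starRingEnd ℂ) T ((Matrix.diagonal dV).map ι) = Matrix.diagonal ![(1 : ℂ), -1]) →
      (∀ τ' : L →+* ℂ, InfinitePlace.mk τ' ≠ InfinitePlace.mk ι → ((Matrix.diagonal dV).map τ').PosDef) →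
      4 ≤ Module.finrank ℚ L →
      ∀ (𝔣 : ConeFrame L H (cmPlace L ι))
        (μ : Measure (adelicGroupData (↥(maximalRealSubfield L)) L (IsCMField.complexConj L) 2 H).automorphicQuotient)
        [(adelicGroupData (↥(maximalRealSubfield L)) L (IsCMField.complexConj L) 2 H).IsAutomorphicMeasure μ]
        (W : Type) [AddCommGroup W] [Module ℂ W]
        (σ : Representation ℂ (finAdelic (↥(maximalRealSubfield L)) L (IsCMField.complexConj L) 2 H) W),
        σ.IsIrreducible → σ.IsSmooth →
      ∀ P : DiscreteAutomorphicRep (adelicGroupData (↥(maximalRealSubfield L)) L (IsCMField.complexConj L) 2 H) μ,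
        P.IsHolCotangentAt₂ (IsCMField.complexConj_ne_one L) (UnitaryGroup.complexConj_smul_infinitePlace L) (cmPlace L ι) 𝔣 →
        P.HasFinComponent σ →
        ∃ ψ : W →ₗ[ℂ] ((adelicGroupData (↥(maximalRealSubfield L)) L (IsCMField.complexConj L) 2 H).Adelic → ℂ),
          (∀ (k : finAdelic (↥(maximalRealSubfield L)) L (IsCMField.complexConj L) 2 H) (w : W),
              ψ (σ k w) = rightRep₂ (↥(maximalRealSubfield L)) L (IsCMField.complexConj L) H k (ψ w)) ∧
          (∀ w : W, ψ w ∈ holCotForms₂ (↥(maximalRealSubfield L)) L (IsCMField.complexConj L) H (IsCMField.complexConj_ne_one L)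
              (UnitaryGroup.complexConj_smul_infinitePlace L) (cmPlace L ι) 𝔣 ∧ P.ContainsFun (ψ w)) ∧ ψ ≠ 0 := by
  intro L _ _ _ ι H dV hdV _ t ht g hg _ hdef h4 𝔣 μ _ W _ _ σ hirr hsm P hP hσ
  obtain ⟨τ, hτ⟩ := UnitaryGroup.exists_infinitePlace_ne L h4 ι
  have hanis := S1BettiSliceExclusion.anisotropic_of_formCongr_posDef L H t g dV hg τ (hdef τ hτ)
  haveI := UnitaryGroup.compactSpace_adelicGroupData_automorphicQuotient L 2 H hanis
  obtain ⟨hvt, r, hr, hvv⟩ := frame_hypotheses ι H dV hdV t ht g hg 𝔣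
  exact exists_holValued_of_hasFinComponent hvt hr hvv P hP σ hirr hsm hσ

end Summit.HodgeConjecture.HodgeConjecture.Cruxes.HLiu418.E1pRealise

end
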